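import Literature.MathematicalPhysics.QuantumFieldTheory.Balaban1983to89.B9Thm311CubeLettersGCoerciveDiag
import Literature.MathematicalPhysics.QuantumFieldTheory.Balaban1983to89.B9Eq382CubeLetters
import Literature.MathematicalPhysics.QuantumFieldTheory.Balaban1983to89.B9Thm311PosOfPrincipalAtLettersY
import Literature.MathematicalPhysics.QuantumFieldTheory.Balaban1983to89.B9Eq3104CommutatorGradFormCurl

/-!
# `Balaban1983to89.B9Eq373CubeLettersLaplacian` — [B9] (3.70)–(3.73) p. 404 (with (3.69) and p. 392) AT THE CUBE LETTERS: THE LAPLACIAN PIECE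
# `Δ(1) − Δ(U′)` OF THE REMAINDER `V(A) = Δ_{a,□}(1) − Δ_{a,□}(U′)` HAS THE ONE-SIDED DIAGONAL BOUND `a⟨C,C⟩ + b‖C‖·‖D₁C‖ + e‖D₁C‖²` from a bond window
# `‖U′_μ(x) − 1‖ ≦ ρ` and a plaquette window `‖U′(∂p) − 1‖ ≦ δ` — the first-order input of `B9Thm311CubeLettersGCoerciveDiag` for this piece, PROVED

statement-level skeleton of published theorems with citation tags; proofs where landed; nothing here is a claim about the Yang–Mills mass gap

T. Bałaban, *Propagators for lattice gauge theories in a background field*, Commun. Math. Phys. **99** (1985) 389–434 [`Balaban1985BackgroundPropagators`,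
"[B9]"; held text `paper:balaban1985-cmp99-background-propagators`, journal page = PDF page + 388; pp. 392, 404, 407 read first-hand].

THE PRINT (verbatim).  p. 404: «Let us consider at first the operator Δ(U′U). It is a sum of two operators, Δ(U′U) = D*_{U′U}D_{U′U} + Δ′(U′U). From the
formula (3.10) it follows that Δ′(U′U) is a small perturbation itself in the sense that we have the bound |(Δ′(U′U)X)(b)| ≦ O(1)(Mα₀ + α₁)(Lʲη)⁻² sup|X|,
b ∈ Ω_j (3.69) … Thus we have to investigate only an expansion of the operator D*_{U′U}D_{U′U} … (D_{U′U}A′)_{μν}(x) = (D_UA′)_{μν}(x) + …» (3.70)–(3.73);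
p. 407: «The operator V₃(A) is a local differential operator of the first order satisfying the bound (3.73)»; p. 392 (after (3.10)): Δ′ «is a small
perturbation of D*D».

WHY THIS FILE.  p622725 `B9Thm311CubeLettersGCoerciveDiag` reduces Theorem 3.11 ∕ (3.84)–(3.86) for r05's cube letters to (i) a flat coercivity and a ONE-SIDED
diagonal bound `⟨C, VC⟩ ≦ a⟨C,C⟩ + b‖C‖‖C‖_E + e‖C‖_E²` of the remainder, piece by piece.  THIS FILE proves that bound for the LAPLACIAN piece
`Δ(1) − Δ(U′)` (def-Y `hessY`) at every unitary-valued `U′` from two WINDOWS — `‖U′_μ(x) − 1‖ ≦ ρ` on bonds, `‖U′(∂p) − 1‖ ≦ δ` on plaquettes (the content of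
the (3.35) gauge ∕ p21's `Small337OnCube`; displayed) — with explicit `(a, b, e) = (12(d+1)c_f²δ, 2√(32(d+1)c_f²)·ρ, δ)` against `‖D₁C‖² = ⟨C, Δ(1)C⟩ ≦ ⟨C, Δ_{a,□}(1)C⟩`:
the flat curl square controls the perturbed Hessian from below (n06-j's ★ `trIP_hessY_ge_of_plaquette_small` at `U′`), and the curl itself moves by at most
`√(32(d+1))|c_f|ρ‖C‖` (transporter differences on two edges per plaquette, p38's `curlY_apply_eq`, n06-j's incidence bound `sum_edgeY_le`).  The projection
piece ((3.74)–(3.77)) and the averaging piece ((3.80)–(3.83), r05's `B9Eq383CubeLetters`) are NOT treated here.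

WHAT IS PROVED (sorry-free; 0 `def`; `M_N(ℂ)` fibres, L²-operator norm on the fibres as everywhere in the lineage).
* §1 `norm_inv_sub_one_le` (`‖V⁻¹ − 1‖ = ‖V − 1‖`-type bound for unitary `V`), ★ `hs_R_sub_self_le` (`HS(R(V)X − X) ≦ 4ρ²·HS(X)`).
* §2 `cdB_sub_cdB_one` (the transporter difference on one bond), ★ `hs_curlY_sub_curlY_one_apply_le` (`HS((D_{U′}C − D₁C)(p)) ≦ 8c_f²ρ²Σ_{m<4}HS(C(b_m(p)))`),
  ★ `trIP_curlY_sub_curlY_one_le` (`‖D_{U′}C − D₁C‖₁² ≦ 32(d+1)c_f²ρ²‖C‖₁²`).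
* §3 (private scalar step `x² − 2xt ≦ y²` from `x ≦ y + t`), ★★★ `trIP_hessY_one_sub_hessY_le` (the one-sided diagonal bound against `‖D₁C‖`),
  ★★ `upperDiag_hessY_piece` (the same against the flat cube energy `⟨C, Δ_{a,□}(1)C⟩`, = the Laplacian summand of p622725's `hup`).
* §4 `upperDiag_of_normBound` (a plain `L²` bound is a one-sided bound of zeroth order), ★★★ `deltaACubeY_coercive_of_windows` (Theorem 3.11 for the cube letters at a
  unitary-valued `U′`: coercivity of `Δ_{a,□}(U′)` WITH CONSTANT from the two windows, the flat `m`, and one-sided bounds for the projection and averaging pieces ONLY).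

HONEST SCOPE.  Finite-lattice Hilbert–Schmidt algebra over landed letters; the two windows are displayed hypotheses (print: consequences of (3.35)∕(3.37) in the
gauge, p. 404 «the estimates follow directly from the assumptions (3.35), (3.37)»); r05's member-vs-cube localisation caveat (`B9Thm311CubeLettersG`, HONEST SCOPE)
applies verbatim — the windows are asked on the whole member torus; `L²` only; count-neutral; NOT a node discharge; no summit ∕ sub-problem claim (rungs R3∕R4
conditional; nothing continuum ∕ OS ∕ mass gap; not Clay).  No `sorry`∕`axiom`∕`instance`∕`notation`; NEW file.  Seat `ym-inputs-p02`, cell `pub/ym-inputs`, 2026-08-28.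
-/

namespace Literature.MathematicalPhysics.QuantumFieldTheory.Balaban1983to89.B9Eq373CubeLettersLaplacian

open B9Thm311ReadingCoords B9Thm311DeltaPrimePos B9Thm31SiteGpBoundsReg335Y Node00 B9CubeLettersBondOpsL0
  B9Thm311AdjointAtLetters B9Thm311CubeLettersGCoercive B9Eq382CubeLetters B9Thm311CubeLettersGCoerciveDiag B9Ineq369CurvatureSmallAtLettersY
  B9Thm311PosOfPrincipalAtLettersY B9Thm311CoercivePureGaugeAtLettersY B9Eq3104CommutatorGradFormCurl
open Literature.MathematicalPhysics.QuantumFieldTheory.Balaban1983to89.B6KLevelCensusIndexV1 (KIdx)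
open Literature.MathematicalPhysics.QuantumFieldTheory.Balaban1983to89.B6Cover236MultiLevelBlocks (cubes)
open Literature.MathematicalPhysics.QuantumFieldTheory.Balaban1983to89.B9Eq3132CoerciveVariational (trIP_sub_right)
open Literature.MathematicalPhysics.QuantumFieldTheory.Balaban1983to89.B9Eq39Adjoint (R R_one R_sub)
open scoped Matrix

noncomputable section

/-! ## §1 The adjoint action of a near-identity unitary moves a matrix by little, in `HS` -/

section Fibre

open scoped Matrix.Norms.L2Operator

variable {N : ℕ}

/-- for a unitary `V`, `‖V⁻¹ − 1‖ = ‖(V − 1)ᴴ‖ = ‖V − 1‖`. [cite: Balaban1985BackgroundPropagators, (3.5) p.391 (U(x,x′) = U(x′,x)⁻¹); folklore] -/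
theorem norm_inv_sub_one_le {V : (Matrix (Fin N) (Fin N) ℂ)ˣ} (hV : (V : Matrix (Fin N) (Fin N) ℂ) ∈ unitary (Matrix (Fin N) (Fin N) ℂ)) {ρ : ℝ}
    (hρ : ‖(V : Matrix (Fin N) (Fin N) ℂ) - 1‖ ≤ ρ) : ‖((V⁻¹ : (Matrix (Fin N) (Fin N) ℂ)ˣ) : Matrix (Fin N) (Fin N) ℂ) - 1‖ ≤ ρ := by
  rw [val_inv_eq_conjTranspose V hV]
  have h : (V : Matrix (Fin N) (Fin N) ℂ)ᴴ - 1 = ((V : Matrix (Fin N) (Fin N) ℂ) - 1)ᴴ := by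
    rw [Matrix.conjTranspose_sub, Matrix.conjTranspose_one]
  rw [h, Matrix.l2_opNorm_conjTranspose]
  exact hρ

/-- ★ **`HS(R(V)X − X) ≦ 4ρ²·HS(X)`** for a unitary `V` with `‖V − 1‖ ≦ ρ`: `VXV⁻¹ − X = (V − 1)XV⁻¹ + X(V⁻¹ − 1)`, each summand costing `ρ` in the operator norm
(the tree's `hs_mul_left_le` ∕ `hs_mul_right_le`). [cite: Balaban1985BackgroundPropagators, (3.70) p.404 («η⁻¹(exp ηi ad_{A(x)} − 1)…»); folklore] -/
theorem hs_R_sub_self_le {V : (Matrix (Fin N) (Fin N) ℂ)ˣ} (hV : (V : Matrix (Fin N) (Fin N) ℂ) ∈ unitary (Matrix (Fin N) (Fin N) ℂ)) {ρ : ℝ}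
    (hρ : ‖(V : Matrix (Fin N) (Fin N) ℂ) - 1‖ ≤ ρ) (X : Matrix (Fin N) (Fin N) ℂ) :
    ∑ a, ∑ b, ‖(R V X - X) a b‖ ^ 2 ≤ 4 * ρ ^ 2 * ∑ a, ∑ b, ‖X a b‖ ^ 2 := by
  set Vm : Matrix (Fin N) (Fin N) ℂ := (V : Matrix (Fin N) (Fin N) ℂ)
  set Vi : Matrix (Fin N) (Fin N) ℂ := ((V⁻¹ : (Matrix (Fin N) (Fin N) ℂ)ˣ) : Matrix (Fin N) (Fin N) ℂ)
  have hsplit : R V X - X = (Vm - 1) * (X * Vi) + X * (Vi - 1) := by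
    have hVi : Vm * Vi = 1 := by simp [Vm, Vi]
    simp only [R, sub_mul, mul_sub, one_mul, mul_one, Vm, Vi]
    noncomm_ring
  have hc := contractive_of_mem_unitary hV
  have hVi1 : ‖Vi‖ ≤ 1 := hc.2
  have hVm : ‖Vm - 1‖ ≤ ρ := hρ
  have hVi : ‖Vi - 1‖ ≤ ρ := norm_inv_sub_one_le hV hρ
  have hX := hs_nonneg X
  have h1 : ∑ a, ∑ b, ‖((Vm - 1) * (X * Vi)) a b‖ ^ 2 ≤ ρ ^ 2 * ∑ a, ∑ b, ‖X a b‖ ^ 2 := by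
    calc ∑ a, ∑ b, ‖((Vm - 1) * (X * Vi)) a b‖ ^ 2 ≤ ‖Vm - 1‖ ^ 2 * ∑ a, ∑ b, ‖(X * Vi) a b‖ ^ 2 := hs_mul_left_le _ _
      _ ≤ ‖Vm - 1‖ ^ 2 * (‖Vi‖ ^ 2 * ∑ a, ∑ b, ‖X a b‖ ^ 2) := mul_le_mul_of_nonneg_left (hs_mul_right_le _ _) (sq_nonneg _)
      _ ≤ ρ ^ 2 * (1 * ∑ a, ∑ b, ‖X a b‖ ^ 2) := by
          refine mul_le_mul (pow_le_pow_left₀ (norm_nonneg _) hVm 2) ?_ (by positivity) (sq_nonneg _)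
          exact mul_le_mul_of_nonneg_right (by nlinarith [norm_nonneg Vi]) hX
      _ = ρ ^ 2 * ∑ a, ∑ b, ‖X a b‖ ^ 2 := by rw [one_mul]
  have h2 : ∑ a, ∑ b, ‖(X * (Vi - 1)) a b‖ ^ 2 ≤ ρ ^ 2 * ∑ a, ∑ b, ‖X a b‖ ^ 2 :=
    le_trans (hs_mul_right_le _ _) (mul_le_mul_of_nonneg_right (pow_le_pow_left₀ (norm_nonneg _) hVi 2) hX)
  calc ∑ a, ∑ b, ‖(R V X - X) a b‖ ^ 2 = ∑ a, ∑ b, ‖((Vm - 1) * (X * Vi) + X * (Vi - 1)) a b‖ ^ 2 := by rw [hsplit]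
    _ ≤ 2 * ∑ a, ∑ b, ‖((Vm - 1) * (X * Vi)) a b‖ ^ 2 + 2 * ∑ a, ∑ b, ‖(X * (Vi - 1)) a b‖ ^ 2 := hs_add_le _ _
    _ ≤ 2 * (ρ ^ 2 * ∑ a, ∑ b, ‖X a b‖ ^ 2) + 2 * (ρ ^ 2 * ∑ a, ∑ b, ‖X a b‖ ^ 2) := by linarith
    _ = 4 * ρ ^ 2 * ∑ a, ∑ b, ‖X a b‖ ^ 2 := by ring

end Fibre

/-! ## §2 The curl moves by `O(ρ)` in `L²` -/

section Curl

open scoped Matrix.Norms.L2Operator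

variable {d ℓ : ℕ} {hd : 1 ≤ d + 1} {hL : Odd (ℓ + 1) ∧ 1 < ℓ + 1} {b₀ b₁ : ℝ} {N : ℕ}
variable (i : KIdx d ℓ hd hL b₀ b₁) {U : CfgY (Matrix (Fin N) (Fin N) ℂ) i}

/-- the transporter difference on one bond: `(∇_{U,μ}A)(b) − (∇_{1,μ}A)(b) = c_f·(R(U_μ(x))A(x + e_μ) − A(x + e_μ))`.
[cite: Balaban1985BackgroundPropagators, (3.70) p.404, (3.3) p.390] -/
theorem cdB_sub_cdB_one (μ : Fin (d + 1)) (A : FBondY i → Matrix (Fin N) (Fin N) ℂ) (b : FBondY i) :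
    cdB i U μ A b - cdB i (fun _ _ => 1 : CfgY (Matrix (Fin N) (Fin N) ℂ) i) μ A b =
      ((i.cf : ℝ) : ℂ) • (R (U μ b.src) (A ⟨b.src.shift μ, b.dir⟩) - A ⟨b.src.shift μ, b.dir⟩) := by
  have e1 : cdB i U μ A b = ((i.cf : ℝ) : ℂ) • (R (U μ b.src) (A ⟨b.src.shift μ, b.dir⟩) - A b) := rfl
  have e2 : cdB i (fun _ _ => 1 : CfgY (Matrix (Fin N) (Fin N) ℂ) i) μ A b = ((i.cf : ℝ) : ℂ) • (R 1 (A ⟨b.src.shift μ, b.dir⟩) - A b) := rfl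
  rw [e1, e2, R_one, ← smul_sub, sub_sub_sub_cancel_right]

/-- ★ **PER PLAQUETTE**: for a unitary-valued `U` with `‖U_μ(x) − 1‖ ≦ ρ` on every bond, `HS((D_UC − D₁C)(p)) ≦ 8c_f²ρ²·Σ_{m<4} HS(C(b_m(p)))` — only the two
transported edges `b₀(p) = (x + e_ν, μ)`, `b₃(p) = (x + e_μ, ν)` of the contour move. [cite: Balaban1985BackgroundPropagators, (3.70)–(3.72) p.404, (3.4)–(3.5) p.391] -/
theorem hs_curlY_sub_curlY_one_apply_le
    (hU : ∀ μ x, ((U μ x : (Matrix (Fin N) (Fin N) ℂ)ˣ) : Matrix (Fin N) (Fin N) ℂ) ∈ unitary (Matrix (Fin N) (Fin N) ℂ)) {ρ : ℝ}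
    (hρ : ∀ μ x, ‖((U μ x : (Matrix (Fin N) (Fin N) ℂ)ˣ) : Matrix (Fin N) (Fin N) ℂ) - 1‖ ≤ ρ)
    (C : FBondY i → Matrix (Fin N) (Fin N) ℂ) (p : PlaqY i) :
    ∑ a, ∑ b, ‖(curlY i U C - curlY i (fun _ _ => 1 : CfgY (Matrix (Fin N) (Fin N) ℂ) i) C) p a b‖ ^ 2 ≤
      8 * i.cf ^ 2 * ρ ^ 2 * ∑ m : Fin 4, ∑ a, ∑ b, ‖C (edgeY i p m) a b‖ ^ 2 := by
  -- the difference at `p` as two transporter differences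
  have hdiff : (curlY i U C - curlY i (fun _ _ => 1 : CfgY (Matrix (Fin N) (Fin N) ℂ) i) C) p =
      ((i.cf : ℝ) : ℂ) • (R (U p.μ p.src) (C ⟨p.src.shift p.μ, p.ν⟩) - C ⟨p.src.shift p.μ, p.ν⟩) -
        ((i.cf : ℝ) : ℂ) • (R (U p.ν p.src) (C ⟨p.src.shift p.ν, p.μ⟩) - C ⟨p.src.shift p.ν, p.μ⟩) := by
    rw [Pi.sub_apply, curlY_apply_eq, curlY_apply_eq, ← cdB_sub_cdB_one i p.μ C ⟨p.src, p.ν⟩, ← cdB_sub_cdB_one i p.ν C ⟨p.src, p.μ⟩]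
    abel
  have hcf : ‖((i.cf : ℝ) : ℂ)‖ ^ 2 = i.cf ^ 2 := by rw [Complex.norm_real, Real.norm_eq_abs, sq_abs]
  have hA := hs_R_sub_self_le (hU p.μ p.src) (hρ p.μ p.src) (C ⟨p.src.shift p.μ, p.ν⟩)
  have hB := hs_R_sub_self_le (hU p.ν p.src) (hρ p.ν p.src) (C ⟨p.src.shift p.ν, p.μ⟩)
  have h0 : edgeY i p 0 = ⟨p.src.shift p.ν, p.μ⟩ := rfl
  have h3 : edgeY i p 3 = ⟨p.src.shift p.μ, p.ν⟩ := rfl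
  have hsum : ∑ a, ∑ b, ‖C ⟨p.src.shift p.μ, p.ν⟩ a b‖ ^ 2 + ∑ a, ∑ b, ‖C ⟨p.src.shift p.ν, p.μ⟩ a b‖ ^ 2 ≤
      ∑ m : Fin 4, ∑ a, ∑ b, ‖C (edgeY i p m) a b‖ ^ 2 := by
    rw [Fin.sum_univ_four, h0, h3]
    linarith [hs_nonneg (C (edgeY i p 1)), hs_nonneg (C (edgeY i p 2))]
  rw [hdiff]
  calc _ ≤ 2 * ∑ a, ∑ b, ‖(((i.cf : ℝ) : ℂ) • (R (U p.μ p.src) (C ⟨p.src.shift p.μ, p.ν⟩) - C ⟨p.src.shift p.μ, p.ν⟩)) a b‖ ^ 2 +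
        2 * ∑ a, ∑ b, ‖(((i.cf : ℝ) : ℂ) • (R (U p.ν p.src) (C ⟨p.src.shift p.ν, p.μ⟩) - C ⟨p.src.shift p.ν, p.μ⟩)) a b‖ ^ 2 := hs_sub_le _ _
    _ = 2 * (i.cf ^ 2 * ∑ a, ∑ b, ‖(R (U p.μ p.src) (C ⟨p.src.shift p.μ, p.ν⟩) - C ⟨p.src.shift p.μ, p.ν⟩) a b‖ ^ 2) +
        2 * (i.cf ^ 2 * ∑ a, ∑ b, ‖(R (U p.ν p.src) (C ⟨p.src.shift p.ν, p.μ⟩) - C ⟨p.src.shift p.ν, p.μ⟩) a b‖ ^ 2) := by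
          rw [hs_smul, hs_smul, hcf]
    _ ≤ 2 * (i.cf ^ 2 * (4 * ρ ^ 2 * ∑ a, ∑ b, ‖C ⟨p.src.shift p.μ, p.ν⟩ a b‖ ^ 2)) +
        2 * (i.cf ^ 2 * (4 * ρ ^ 2 * ∑ a, ∑ b, ‖C ⟨p.src.shift p.ν, p.μ⟩ a b‖ ^ 2)) := by
          have hc2 : 0 ≤ i.cf ^ 2 := sq_nonneg _
          nlinarith [mul_le_mul_of_nonneg_left hA hc2, mul_le_mul_of_nonneg_left hB hc2]
    _ = 8 * i.cf ^ 2 * ρ ^ 2 * (∑ a, ∑ b, ‖C ⟨p.src.shift p.μ, p.ν⟩ a b‖ ^ 2 + ∑ a, ∑ b, ‖C ⟨p.src.shift p.ν, p.μ⟩ a b‖ ^ 2) := by ring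
    _ ≤ 8 * i.cf ^ 2 * ρ ^ 2 * ∑ m : Fin 4, ∑ a, ∑ b, ‖C (edgeY i p m) a b‖ ^ 2 := mul_le_mul_of_nonneg_left hsum (by positivity)

/-- ★ **IN `L²`**: `‖D_UC − D₁C‖₁² ≦ 32(d+1)c_f²ρ²·‖C‖₁²` (sum over plaquettes; each bond lies on at most `4(d+1)` contours, n06-j's `sum_edgeY_le`).
[cite: Balaban1985BackgroundPropagators, (3.70)–(3.73) p.404, (3.69) p.404 («bonds belonging to one of the plaquettes containing the bond b»)] -/
theorem trIP_curlY_sub_curlY_one_le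
    (hU : ∀ μ x, ((U μ x : (Matrix (Fin N) (Fin N) ℂ)ˣ) : Matrix (Fin N) (Fin N) ℂ) ∈ unitary (Matrix (Fin N) (Fin N) ℂ)) {ρ : ℝ}
    (hρ : ∀ μ x, ‖((U μ x : (Matrix (Fin N) (Fin N) ℂ)ˣ) : Matrix (Fin N) (Fin N) ℂ) - 1‖ ≤ ρ)
    (C : FBondY i → Matrix (Fin N) (Fin N) ℂ) :
    trIP (fun _ => (1 : ℝ)) (curlY i U C - curlY i (fun _ _ => 1 : CfgY (Matrix (Fin N) (Fin N) ℂ) i) C)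
        (curlY i U C - curlY i (fun _ _ => 1 : CfgY (Matrix (Fin N) (Fin N) ℂ) i) C) ≤
      32 * (d + 1) * i.cf ^ 2 * ρ ^ 2 * trIP (fun _ => (1 : ℝ)) C C := by
  rw [trIP_one_self_eq, trIP_one_self_eq]
  have h1 := Finset.sum_le_sum fun p (_ : p ∈ Finset.univ) => hs_curlY_sub_curlY_one_apply_le i hU hρ C p
  have h2 := sum_edgeY_le i (g := fun b => ∑ a, ∑ b', ‖C b a b'‖ ^ 2) fun _ => hs_nonneg _
  calc _ ≤ ∑ p : PlaqY i, 8 * i.cf ^ 2 * ρ ^ 2 * ∑ m : Fin 4, ∑ a, ∑ b, ‖C (edgeY i p m) a b‖ ^ 2 := h1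
    _ = 8 * i.cf ^ 2 * ρ ^ 2 * ∑ p : PlaqY i, ∑ m : Fin 4, ∑ a, ∑ b, ‖C (edgeY i p m) a b‖ ^ 2 := by rw [Finset.mul_sum]
    _ ≤ 8 * i.cf ^ 2 * ρ ^ 2 * (4 * (d + 1) * ∑ b : FBondY i, ∑ a, ∑ b', ‖C b a b'‖ ^ 2) := mul_le_mul_of_nonneg_left h2 (by positivity)
    _ = 32 * (d + 1) * i.cf ^ 2 * ρ ^ 2 * ∑ b : FBondY i, ∑ a, ∑ b', ‖C b a b'‖ ^ 2 := by ring

end Curl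

/-! ## §3 The one-sided diagonal bound of the Laplacian piece -/

section Laplacian

open scoped Matrix.Norms.L2Operator

/-- the scalar step: `0 ≦ y`, `x ≦ y + t` (from `‖u‖ ≦ ‖v‖ + ‖u − v‖`) give `x² − 2xt ≦ y²` for `x, t ≧ 0`. [folklore] -/
private theorem sq_sub_two_mul_le_of_dist {x y t : ℝ} (hx : 0 ≤ x) (hy : 0 ≤ y) (ht : 0 ≤ t) (h : x ≤ y + t) : x ^ 2 - 2 * x * t ≤ y ^ 2 := by
  rcases le_or_gt t x with htx | htx
  · have h1 : x - t ≤ y := by linarith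
    have h2 : 0 ≤ x - t := by linarith
    nlinarith [mul_le_mul h1 h1 h2 hy]
  · nlinarith

variable {d ℓ : ℕ} {hd : 1 ≤ d + 1} {hL : Odd (ℓ + 1) ∧ 1 < ℓ + 1} {b₀ b₁ : ℝ} {N : ℕ}
variable (i : KIdx d ℓ hd hL b₀ b₁) {U : CfgY (Matrix (Fin N) (Fin N) ℂ) i}

/-- ★★★ **THE LAPLACIAN PIECE OF `V(A)`, ONE-SIDED DIAGONAL BOUND**: for a unitary-valued `U′` with bond window `ρ` and plaquette window `δ ∈ [0, 1]`,
`⟨C, (Δ(1) − Δ(U′))C⟩₁ ≦ 12(d+1)c_f²δ·⟨C,C⟩₁ + 2√(32(d+1)c_f²)·ρ·‖C‖₁·‖D₁C‖₁ + δ·‖D₁C‖₁²` — (3.73)'s first-order shape: the coefficient of the derivative is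
`O(ρ)` (print's `|A| ≦ α₁(Lʲη)⁻¹`), the zeroth-order coefficient is `O(δ)` (print's (3.69), `(Lʲη)⁻²` inside `c_f²δ`).  Ingredients BY NAME: n06-j's
`trIP_hessY_ge_of_plaquette_small` (the perturbed Hessian from below by `(1−δ)‖D_{U′}C‖² − 12(d+1)c_f²δ‖C‖²`) and `trIP_hessY_eq_curl_of_flat` (at `U = 1`), §2.
[cite: Balaban1985BackgroundPropagators, (3.69)–(3.73) p.404, (3.10) p.392, (3.84) p.407] -/
theorem trIP_hessY_one_sub_hessY_le
    (hU : ∀ μ x, ((U μ x : (Matrix (Fin N) (Fin N) ℂ)ˣ) : Matrix (Fin N) (Fin N) ℂ) ∈ unitary (Matrix (Fin N) (Fin N) ℂ)) {ρ δ : ℝ} (hρ0 : 0 ≤ ρ)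
    (hρ : ∀ μ x, ‖((U μ x : (Matrix (Fin N) (Fin N) ℂ)ˣ) : Matrix (Fin N) (Fin N) ℂ) - 1‖ ≤ ρ) (hδ0 : 0 ≤ δ) (hδ1 : δ ≤ 1)
    (hδ : ∀ p : PlaqY i, ‖((holY i U p : (Matrix (Fin N) (Fin N) ℂ)ˣ) : Matrix (Fin N) (Fin N) ℂ) - 1‖ ≤ δ)
    (C : FBondY i → Matrix (Fin N) (Fin N) ℂ) :
    trIP (fun _ => (1 : ℝ)) C ((hessY i (fun _ _ => 1 : CfgY (Matrix (Fin N) (Fin N) ℂ) i) - hessY i U) C) ≤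
      12 * (d + 1) * i.cf ^ 2 * δ * trIP (fun _ => (1 : ℝ)) C C +
        2 * Real.sqrt (32 * (d + 1) * i.cf ^ 2) * ρ * Real.sqrt (trIP (fun _ => (1 : ℝ)) C C) *
          Real.sqrt (trIP (fun _ => (1 : ℝ)) (curlY i (fun _ _ => 1 : CfgY (Matrix (Fin N) (Fin N) ℂ) i) C)
            (curlY i (fun _ _ => 1 : CfgY (Matrix (Fin N) (Fin N) ℂ) i) C)) +
        δ * trIP (fun _ => (1 : ℝ)) (curlY i (fun _ _ => 1 : CfgY (Matrix (Fin N) (Fin N) ℂ) i) C)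
          (curlY i (fun _ _ => 1 : CfgY (Matrix (Fin N) (Fin N) ℂ) i) C) := by
  have hw : ∀ _ : PlaqY i, (0 : ℝ) < 1 := fun _ => one_pos
  have hwb : ∀ _ : FBondY i, (0 : ℝ) < 1 := fun _ => one_pos
  -- the three squares: `trD1 = ‖D₁C‖²`, `trDU = ‖D_UC‖²`, `trC = ‖C‖²`
  have hD1 : 0 ≤ trIP (fun _ => (1 : ℝ)) (curlY i (fun _ _ => 1 : CfgY (Matrix (Fin N) (Fin N) ℂ) i) C)
      (curlY i (fun _ _ => 1 : CfgY (Matrix (Fin N) (Fin N) ℂ) i) C) := trIP_self_nonneg _ hw _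
  have hDU : 0 ≤ trIP (fun _ => (1 : ℝ)) (curlY i U C) (curlY i U C) := trIP_self_nonneg _ hw _
  have hC : 0 ≤ trIP (fun _ => (1 : ℝ)) C C := trIP_self_nonneg _ hwb _
  have hκ0 : 0 ≤ 32 * ((d : ℝ) + 1) * i.cf ^ 2 := by positivity
  -- `t = ‖D_UC − D₁C‖ ≦ κρ‖C‖`
  have hdiff := trIP_curlY_sub_curlY_one_le i hU hρ C
  have ht : Real.sqrt (trIP (fun _ => (1 : ℝ)) (curlY i U C - curlY i (fun _ _ => 1 : CfgY (Matrix (Fin N) (Fin N) ℂ) i) C)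
      (curlY i U C - curlY i (fun _ _ => 1 : CfgY (Matrix (Fin N) (Fin N) ℂ) i) C)) ≤
      Real.sqrt (32 * (d + 1) * i.cf ^ 2) * ρ * Real.sqrt (trIP (fun _ => (1 : ℝ)) C C) := by
    have hprod : 0 ≤ Real.sqrt (32 * (d + 1) * i.cf ^ 2) * ρ * Real.sqrt (trIP (fun _ => (1 : ℝ)) C C) :=
      mul_nonneg (mul_nonneg (Real.sqrt_nonneg _) hρ0) (Real.sqrt_nonneg _)
    rw [← Real.sqrt_sq hprod]
    refine Real.sqrt_le_sqrt ?_
    rw [mul_pow, mul_pow, Real.sq_sqrt hκ0, Real.sq_sqrt hC]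
    exact hdiff
  -- `‖D₁C‖ ≦ ‖D_UC‖ + t` (triangle inequality of the trace norm)
  have htri : Real.sqrt (trIP (fun _ => (1 : ℝ)) (curlY i (fun _ _ => 1 : CfgY (Matrix (Fin N) (Fin N) ℂ) i) C)
      (curlY i (fun _ _ => 1 : CfgY (Matrix (Fin N) (Fin N) ℂ) i) C)) ≤
      Real.sqrt (trIP (fun _ => (1 : ℝ)) (curlY i U C) (curlY i U C)) +
        Real.sqrt (32 * (d + 1) * i.cf ^ 2) * ρ * Real.sqrt (trIP (fun _ => (1 : ℝ)) C C) := by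
    have h1 : curlY i (fun _ _ => 1 : CfgY (Matrix (Fin N) (Fin N) ℂ) i) C =
        curlY i U C + (curlY i (fun _ _ => 1 : CfgY (Matrix (Fin N) (Fin N) ℂ) i) C - curlY i U C) := by abel
    have h2 := sqrt_trIP_add_self_le hw (curlY i U C) (curlY i (fun _ _ => 1 : CfgY (Matrix (Fin N) (Fin N) ℂ) i) C - curlY i U C)
    rw [← h1] at h2
    have h3 : trIP (fun _ => (1 : ℝ)) (curlY i (fun _ _ => 1 : CfgY (Matrix (Fin N) (Fin N) ℂ) i) C - curlY i U C)
        (curlY i (fun _ _ => 1 : CfgY (Matrix (Fin N) (Fin N) ℂ) i) C - curlY i U C) =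
        trIP (fun _ => (1 : ℝ)) (curlY i U C - curlY i (fun _ _ => 1 : CfgY (Matrix (Fin N) (Fin N) ℂ) i) C)
        (curlY i U C - curlY i (fun _ _ => 1 : CfgY (Matrix (Fin N) (Fin N) ℂ) i) C) := by
      rw [← neg_sub (curlY i U C), trIP_neg_neg]
    rw [h3] at h2
    linarith
  -- `‖D₁C‖² − 2‖D₁C‖·t ≦ ‖D_UC‖²`
  have hstep := sq_sub_two_mul_le_of_dist (Real.sqrt_nonneg _) (Real.sqrt_nonneg _)
    (mul_nonneg (mul_nonneg (Real.sqrt_nonneg _) hρ0) (Real.sqrt_nonneg _)) htri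
  rw [Real.sq_sqrt hD1, Real.sq_sqrt hDU] at hstep
  -- the perturbed Hessian from below, the flat one exactly
  have hlow := trIP_hessY_ge_of_plaquette_small i hU hδ0 hδ C
  have hflat : trIP (fun _ => (1 : ℝ)) C (hessY i (fun _ _ => 1 : CfgY (Matrix (Fin N) (Fin N) ℂ) i) C) =
      trIP (fun _ => (1 : ℝ)) (curlY i (fun _ _ => 1 : CfgY (Matrix (Fin N) (Fin N) ℂ) i) C)
        (curlY i (fun _ _ => 1 : CfgY (Matrix (Fin N) (Fin N) ℂ) i) C) :=
    trIP_hessY_eq_curl_of_flat i (fun _ _ => by simp) (fun p => holY_one i p) C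
  rw [LinearMap.sub_apply, trIP_sub_right, hflat]
  -- bookkeeping: `x² − (1−δ)y² + a c² ≦ δx² + 2(1−δ)x t + a c² ≦ δx² + 2 x t + a c²`
  have h1δ : 0 ≤ 1 - δ := by linarith
  have hxt : 0 ≤ Real.sqrt (trIP (fun _ => (1 : ℝ)) (curlY i (fun _ _ => 1 : CfgY (Matrix (Fin N) (Fin N) ℂ) i) C)
      (curlY i (fun _ _ => 1 : CfgY (Matrix (Fin N) (Fin N) ℂ) i) C)) *
      (Real.sqrt (32 * (d + 1) * i.cf ^ 2) * ρ * Real.sqrt (trIP (fun _ => (1 : ℝ)) C C)) :=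
    mul_nonneg (Real.sqrt_nonneg _) (mul_nonneg (mul_nonneg (Real.sqrt_nonneg _) hρ0) (Real.sqrt_nonneg _))
  have H2 := mul_le_mul_of_nonneg_left hstep h1δ
  have H5 := mul_nonneg hδ0 hxt
  have H6 := mul_nonneg hδ0 hD1
  nlinarith [H2, H5, H6, hlow, hxt]

variable (q : ↥(cubes (toKT i).D.toDomains))

/-- ★★ **THE LAPLACIAN SUMMAND OF p622725's ONE-SIDED INPUT**: the same bound against the flat cube energy `⟨C, Δ_{a,□}(1)C⟩ ≧ ‖D₁C‖²`
(`B9Thm311CubeLettersGCoerciveDiag.trIP_curlY_one_self_le_energy`, `0 < b₀`), i.e. `(a, b, e) = (12(d+1)c_f²δ, 2√(32(d+1)c_f²)·ρ, δ)` for the piece `hessY 1 − hessY U′`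
in the shape `a⟨C,C⟩ + b‖C‖⟨C, Δ_{a,□}(1)C⟩^{1/2} + e⟨C, Δ_{a,□}(1)C⟩` that `deltaACubeY_coercive_of_upperDiagBound` consumes (the projection and averaging pieces add).
[cite: Balaban1985BackgroundPropagators, (3.73) p.404, (3.82)–(3.84) p.407, Thm 3.11 p.416] -/
theorem upperDiag_hessY_piece (hb₀ : 0 < b₀)
    (hU : ∀ μ x, ((U μ x : (Matrix (Fin N) (Fin N) ℂ)ˣ) : Matrix (Fin N) (Fin N) ℂ) ∈ unitary (Matrix (Fin N) (Fin N) ℂ)) {ρ δ : ℝ} (hρ0 : 0 ≤ ρ)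
    (hρ : ∀ μ x, ‖((U μ x : (Matrix (Fin N) (Fin N) ℂ)ˣ) : Matrix (Fin N) (Fin N) ℂ) - 1‖ ≤ ρ) (hδ0 : 0 ≤ δ) (hδ1 : δ ≤ 1)
    (hδ : ∀ p : PlaqY i, ‖((holY i U p : (Matrix (Fin N) (Fin N) ℂ)ˣ) : Matrix (Fin N) (Fin N) ℂ) - 1‖ ≤ δ)
    (C : FBondY i → Matrix (Fin N) (Fin N) ℂ) :
    trIP (fun _ => (1 : ℝ)) C ((hessY i (fun _ _ => 1 : CfgY (Matrix (Fin N) (Fin N) ℂ) i) - hessY i U) C) ≤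
      12 * (d + 1) * i.cf ^ 2 * δ * trIP (fun _ => (1 : ℝ)) C C +
        2 * Real.sqrt (32 * (d + 1) * i.cf ^ 2) * ρ * Real.sqrt (trIP (fun _ => (1 : ℝ)) C C) *
          Real.sqrt (trIP (fun _ => (1 : ℝ)) C (deltaACubeY i q (parSymY i) (parBY i) (fun _ _ => 1 : CfgY (Matrix (Fin N) (Fin N) ℂ) i) C)) +
        δ * trIP (fun _ => (1 : ℝ)) C (deltaACubeY i q (parSymY i) (parBY i) (fun _ _ => 1 : CfgY (Matrix (Fin N) (Fin N) ℂ) i) C) := by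
  have h := trIP_hessY_one_sub_hessY_le i hU hρ0 hρ hδ0 hδ1 hδ C
  have hE := trIP_curlY_one_self_le_energy i q hb₀ C
  have hsq : Real.sqrt (trIP (fun _ => (1 : ℝ)) (curlY i (fun _ _ => 1 : CfgY (Matrix (Fin N) (Fin N) ℂ) i) C)
      (curlY i (fun _ _ => 1 : CfgY (Matrix (Fin N) (Fin N) ℂ) i) C)) ≤
      Real.sqrt (trIP (fun _ => (1 : ℝ)) C (deltaACubeY i q (parSymY i) (parBY i) (fun _ _ => 1 : CfgY (Matrix (Fin N) (Fin N) ℂ) i) C)) :=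
    Real.sqrt_le_sqrt hE
  have hcoef : 0 ≤ 2 * Real.sqrt (32 * (d + 1) * i.cf ^ 2) * ρ * Real.sqrt (trIP (fun _ => (1 : ℝ)) C C) := by positivity
  nlinarith [mul_le_mul_of_nonneg_left hsq hcoef, mul_le_mul_of_nonneg_left hE hδ0]

end Laplacian

/-! ## §4 Assembly: with the Laplacian piece proved, the one-sided input of `B9Thm311CubeLettersGCoerciveDiag` needs only the projection and averaging pieces -/

section Assembly

open scoped Matrix.Norms.L2Operator

variable {d ℓ : ℕ} {hd : 1 ≤ d + 1} {hL : Odd (ℓ + 1) ∧ 1 < ℓ + 1} {b₀ b₁ : ℝ} {N : ℕ}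
variable (i : KIdx d ℓ hd hL b₀ b₁) (q : ↥(cubes (toKT i).D.toDomains)) {U : CfgY (Matrix (Fin N) (Fin N) ℂ) i}

/-- a plain `L²` bound is a one-sided diagonal bound of zeroth order (Cauchy–Schwarz): `‖PC‖ ≦ a‖C‖ ⟹ ⟨C, PC⟩ ≦ a⟨C, C⟩` — the shape in which r05's averaging piece
(`B9Eq383CubeLetters` §4) enters. [cite: Balaban1985BackgroundPropagators, (3.83) p.407; folklore] -/
theorem upperDiag_of_normBound {S : Type} [Fintype S] {w : S → ℝ} (hw : ∀ s, 0 < w s) {P : (S → Matrix (Fin N) (Fin N) ℂ) →ₗ[ℂ] (S → Matrix (Fin N) (Fin N) ℂ)}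
    {a : ℝ} (hP : ∀ C, Real.sqrt (trIP w (P C) (P C)) ≤ a * Real.sqrt (trIP w C C)) (C : S → Matrix (Fin N) (Fin N) ℂ) :
    trIP w C (P C) ≤ a * trIP w C C := by
  have h1 := abs_trIP_le w hw C (P C)
  have h2 : Real.sqrt (trIP w C C) * Real.sqrt (trIP w C C) = trIP w C C := Real.mul_self_sqrt (trIP_self_nonneg w hw C)
  have h3 := mul_le_mul_of_nonneg_left (hP C) (Real.sqrt_nonneg (trIP w C C))
  have h4 : Real.sqrt (trIP w C C) * (a * Real.sqrt (trIP w C C)) = a * (Real.sqrt (trIP w C C) * Real.sqrt (trIP w C C)) := by ring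
  rw [h2] at h4
  linarith [le_abs_self (trIP w C (P C)), h1, h3, h4]

/-- ★★★ **THEOREM 3.11 ∕ (3.84)–(3.86) FOR THE CUBE LETTERS AT A SMALL FIELD, THE LAPLACIAN PIECE DISCHARGED**: at def-Y's v4 transporters (`0 < b₀`), for a
unitary-valued `U′` with windows `ρ` (bonds) and `δ ∈ [0,1]` (plaquettes), a flat coercivity `m⟨C,C⟩ ≦ ⟨C, Δ_{a,□}(1)C⟩`, and ONE-SIDED diagonal bounds `(a₂, b₂, e₂)`,
`(a₃, b₃, e₃)` for the projection piece `D₁R_□(1)D*₁ − D′R_□(U′)D*′` and the averaging piece `Q*_□(1)aQ_□(1) − Q*_□(U′)aQ_□(U′)` (displayed: (3.74)–(3.77), (3.80)–(3.83)):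
with `a := 12(d+1)c_f²δ + a₂ + a₃`, `b := 2√(32(d+1)c_f²)ρ + b₂ + b₃`, `e := δ + e₂ + e₃` and `θ := a∕m + b∕√m + e ≦ 1`,
`(1 − θ)m·⟨C,C⟩ ≦ ⟨C, Δ_{a,□}(U′)C⟩` for all `C`. [cite: Balaban1985BackgroundPropagators, Thm 3.11 p.416, (3.82)–(3.86) p.407, (3.73) p.404, (3.77) p.405, (3.83) p.407] -/
theorem deltaACubeY_coercive_of_windows (hb₀ : 0 < b₀)
    (hU : ∀ μ x, ((U μ x : (Matrix (Fin N) (Fin N) ℂ)ˣ) : Matrix (Fin N) (Fin N) ℂ) ∈ unitary (Matrix (Fin N) (Fin N) ℂ)) {ρ δ : ℝ} (hρ0 : 0 ≤ ρ)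
    (hρ : ∀ μ x, ‖((U μ x : (Matrix (Fin N) (Fin N) ℂ)ˣ) : Matrix (Fin N) (Fin N) ℂ) - 1‖ ≤ ρ) (hδ0 : 0 ≤ δ) (hδ1 : δ ≤ 1)
    (hδ : ∀ p : PlaqY i, ‖((holY i U p : (Matrix (Fin N) (Fin N) ℂ)ˣ) : Matrix (Fin N) (Fin N) ℂ) - 1‖ ≤ δ)
    {m a₂ b₂ e₂ a₃ b₃ e₃ : ℝ} (hm : 0 < m) (ha₂ : 0 ≤ a₂) (hb₂ : 0 ≤ b₂) (ha₃ : 0 ≤ a₃) (hb₃ : 0 ≤ b₃)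
    (hco : ∀ C, m * trIP (fun _ => (1 : ℝ)) C C ≤
      trIP (fun _ => (1 : ℝ)) C (deltaACubeY i q (parSymY i) (parBY i) (fun _ _ => 1 : CfgY (Matrix (Fin N) (Fin N) ℂ) i) C))
    (hR : ∀ C, trIP (fun _ => (1 : ℝ)) C
        ((gradY i (fun _ _ => 1 : CfgY (Matrix (Fin N) (Fin N) ℂ) i) ∘ₗ RCubeY i q (parSymY i) (fun _ _ => 1 : CfgY (Matrix (Fin N) (Fin N) ℂ) i) ∘ₗ
              divY i (fun _ _ => 1 : CfgY (Matrix (Fin N) (Fin N) ℂ) i) -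
            gradY i U ∘ₗ RCubeY i q (parSymY i) U ∘ₗ divY i U) C) ≤
      a₂ * trIP (fun _ => (1 : ℝ)) C C +
        b₂ * Real.sqrt (trIP (fun _ => (1 : ℝ)) C C) *
          Real.sqrt (trIP (fun _ => (1 : ℝ)) C (deltaACubeY i q (parSymY i) (parBY i) (fun _ _ => 1 : CfgY (Matrix (Fin N) (Fin N) ℂ) i) C)) +
        e₂ * trIP (fun _ => (1 : ℝ)) C (deltaACubeY i q (parSymY i) (parBY i) (fun _ _ => 1 : CfgY (Matrix (Fin N) (Fin N) ℂ) i) C))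
    (hQ : ∀ C, trIP (fun _ => (1 : ℝ)) C
        ((QsCubeY i q (parBY i) (fun _ _ => 1 : CfgY (Matrix (Fin N) (Fin N) ℂ) i) ∘ₗ aCubeY i q ∘ₗ
              QCubeY i q (parBY i) (fun _ _ => 1 : CfgY (Matrix (Fin N) (Fin N) ℂ) i) -
            QsCubeY i q (parBY i) U ∘ₗ aCubeY i q ∘ₗ QCubeY i q (parBY i) U) C) ≤
      a₃ * trIP (fun _ => (1 : ℝ)) C C +
        b₃ * Real.sqrt (trIP (fun _ => (1 : ℝ)) C C) *
          Real.sqrt (trIP (fun _ => (1 : ℝ)) C (deltaACubeY i q (parSymY i) (parBY i) (fun _ _ => 1 : CfgY (Matrix (Fin N) (Fin N) ℂ) i) C)) +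
        e₃ * trIP (fun _ => (1 : ℝ)) C (deltaACubeY i q (parSymY i) (parBY i) (fun _ _ => 1 : CfgY (Matrix (Fin N) (Fin N) ℂ) i) C))
    (hθ : (12 * (d + 1) * i.cf ^ 2 * δ + a₂ + a₃) / m + (2 * Real.sqrt (32 * (d + 1) * i.cf ^ 2) * ρ + b₂ + b₃) / Real.sqrt m + (δ + e₂ + e₃) ≤ 1)
    (C : FBondY i → Matrix (Fin N) (Fin N) ℂ) :
    ((1 - ((12 * (d + 1) * i.cf ^ 2 * δ + a₂ + a₃) / m + (2 * Real.sqrt (32 * (d + 1) * i.cf ^ 2) * ρ + b₂ + b₃) / Real.sqrt m + (δ + e₂ + e₃))) * m) *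
        trIP (fun _ => (1 : ℝ)) C C ≤
      trIP (fun _ => (1 : ℝ)) C (deltaACubeY i q (parSymY i) (parBY i) U C) := by
  refine deltaACubeY_coercive_of_upperDiagBound i q (parSymY i) (parBY i) (fun _ _ => 1) U hm (by positivity) (by positivity) hco
    (fun C => ?_) hθ C
  have hH := upperDiag_hessY_piece i q hb₀ hU hρ0 hρ hδ0 hδ1 hδ C
  rw [B9Eq382CubeLetters.deltaACubeY_sub_split, LinearMap.add_apply, LinearMap.add_apply, trIP_add_right, trIP_add_right]
  have h1 := hR C
  have h2 := hQ C
  nlinarith [hH, h1, h2]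

end Assembly

end

end Literature.MathematicalPhysics.QuantumFieldTheory.Balaban1983to89.B9Eq373CubeLettersLaplacian
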